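import Literature.NumberTheory.Automorphic.HidaLevelHeckeEquivariance
import Literature.NumberTheory.Automorphic.LevelActionHeckeMultiplicative
import HarnessLib

/-!
# `res` and `tr` between the Hida levels commute with the Hecke operators — arbitrary coefficients

Topic `NumberTheory/Automorphic`; namespace `Literature.NumberTheory.Automorphic.BigHeckeGLn.TameLevel`;
theorems only (no new definitions, no named fact, no `sorry`).

The coefficient-general form of `HidaLevelHeckeEquivariance` (there: trivial coefficients, `Δ = ⊤`):
for an arbitrary monoid `Δ ⊇ U(b, c)` acting on arbitrary coefficients `τ` (e.g. the multi-place
Iwahori monoid acting on `⨂_τ Sym^{k-2}((𝒪/p^c)²)`), and a Hida element `g ∈ Δ`,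

* **`resCohomology_comp_heckeCohomology_level`** — `res ∘ [U(b₁,c₁) g U(b₁,c₁)] = [U(b₂,c₂) g U(b₂,c₂)] ∘ res`
  (`U(b₂,c₂) ≤ U(b₁,c₁)`, `c₁, c₂ ≥ 1`): the common families of representatives of
  `HidaLevelHeckeEquivariance` (no condition on `Δ` beyond `g ∈ Δ`);
* **`trCohomology_comp_heckeCohomology_level`** — `tr ∘ [U(b,c) g U(b,c)] = [U(b',c) g U(b',c)] ∘ tr`
  (`b' ≤ b ≤ c`, `1 ≤ c`), provided the representatives lie in `Δ`: the unipotent elements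
  `N(x) t_v` (`x` integral, `v ∣ p`) and the local elements `ι_w(y)` at good places `w ∤ p`
  (hypotheses `hNΔ`, `hlocΔ`).

[cite: Hida1994AIF, §2] [cite: KhareThorne2017, §6.2, Lemma 6.5]

## References

* H. Hida, Ann. Inst. Fourier 44 (1994), §2. [Hida1994AIF]
* C. Khare, J. A. Thorne, Amer. J. Math. 139 (2017), §6.2. [KhareThorne2017]
-/

noncomputable section

open CategoryTheory IsDedekindDomain
open scoped NumberField

namespace Literature.NumberTheory.Automorphic

namespace BigHeckeGLn

namespace TameLevel

open LevelAction

variable {K : Type} [Field K] [NumberField K] {p : ℕ} [Fact p.Prime] (𝒰 : TameLevel 2 K p)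
  {R : Type} [CommRing R] {V : Type} [AddCommGroup V] [Module R V]
  (Δ : Submonoid (FiniteAdelicGL 2 K)) (τ : Δ →* Module.End R V)

/-- **`res ∘ [U(b₁,c₁) g U(b₁,c₁)] = [U(b₂,c₂) g U(b₂,c₂)] ∘ res`** on `H^i(·, τ)` for every Hida element
`g ∈ Δ` and `U(b₂,c₂) ≤ U(b₁,c₁) ⊆ Δ` (`c₁, c₂ ≥ 1`, `U` maximal above `p`), arbitrary coefficients.
[cite: KhareThorne2017, §6.2, Lemma 6.5] [cite: Hida1994AIF, §2] -/
theorem resCohomology_comp_heckeCohomology_level (h𝒰 : 𝒰.IsMaximalAbove) {b₁ c₁ b₂ c₂ : ℕ}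
    (hU₁ : (𝒰.level b₁ c₁).toSubmonoid ≤ Δ) (hU₂ : (𝒰.level b₂ c₂).toSubmonoid ≤ Δ)
    (hle : 𝒰.level b₂ c₂ ≤ 𝒰.level b₁ c₁) (hc₁ : 1 ≤ c₁) (hc₂ : 1 ≤ c₂) (i : ℕ)
    {g : FiniteAdelicGL 2 K} (hg : g ∈ 𝒰.hidaElements) (hgΔ : g ∈ Δ) :
    (resCohomology (globalEmbedding 2 K) Δ τ hle i).hom ∘ₗ
        heckeCohomology (globalEmbedding 2 K) Δ τ (𝒰.level b₁ c₁) hU₁ hgΔ i =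
      heckeCohomology (globalEmbedding 2 K) Δ τ (𝒰.level b₂ c₂) hU₂ hgΔ i ∘ₗ
        (resCohomology (globalEmbedding 2 K) Δ τ hle i).hom := by
  classical
  obtain ⟨w, hw, ⟨d, hgd⟩, hcase⟩ := exists_place_of_mem_hidaElements_level 𝒰 h𝒰 hg
  rcases hcase with rfl | ⟨hN, -⟩
  · by_cases hp : (p : 𝓞 K) ∈ w.asIdeal
    · -- `U_{w,1}`: the unipotent family (for `t = t^1`)
      have hgΔ' : heckeElement 2 K w 1 ^ 1 ∈ Δ := by rwa [pow_one]
      rw [heckeCohomology_congr (globalEmbedding 2 K) Δ τ (𝒰.level b₁ c₁) hU₁ hgΔ hgΔ' (pow_one _).symm i,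
        heckeCohomology_congr (globalEmbedding 2 K) Δ τ (𝒰.level b₂ c₂) hU₂ hgΔ hgΔ' (pow_one _).symm i]
      exact resCohomology_comp_heckeCohomology_of_bijOn (globalEmbedding 2 K) Δ τ hU₂ hU₁ hle hgΔ'
        (𝒰.unipotentFamily (v := w) 1 1)
        (𝒰.coe_unipotentFamily_bijOn_level h𝒰 hp le_rfl hc₂)
        (𝒰.coe_unipotentFamily_bijOn_level h𝒰 hp le_rfl hc₁) i
    · -- `T_{w,1}` at a good place: the local family
      have hw' : w ∉ 𝒰.bad := Or.resolve_right hw hp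
      haveI := (𝒰.finite_localOrbit hw' b₁ c₁ (glDiagonal 2 (w.adicCompletion K) d)).fintype
      have hgΔ' : ofLocal 2 K w (glDiagonal 2 (w.adicCompletion K) d) ∈ Δ := by rwa [← hgd]
      rw [heckeCohomology_congr (globalEmbedding 2 K) Δ τ (𝒰.level b₁ c₁) hU₁ hgΔ hgΔ' hgd i,
        heckeCohomology_congr (globalEmbedding 2 K) Δ τ (𝒰.level b₂ c₂) hU₂ hgΔ hgΔ' hgd i]
      exact resCohomology_comp_heckeCohomology_of_bijOn (globalEmbedding 2 K) Δ τ hU₂ hU₁ hle hgΔ' _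
        (bijOn_localFamily (𝒰.isUnramifiedLevel_levelAt_of_not_mem (fun v => iwahoriLevel 2 v.1 b₂ c₂) hw') _)
        (bijOn_localFamily (𝒰.isUnramifiedLevel_levelAt_of_not_mem (fun v => iwahoriLevel 2 v.1 b₁ c₁) hw') _) i
  · -- normalising elements
    exact resCohomology_comp_heckeCohomology_of_bijOn (globalEmbedding 2 K) Δ τ hU₂ hU₁ hle hgΔ
      (fun _ : Unit => g) (bijOn_unit_of_normalizing _ (hN b₂ c₂)) (bijOn_unit_of_normalizing _ (hN b₁ c₁)) i

/-- **`tr ∘ [U(b,c) g U(b,c)] = [U(b',c) g U(b',c)] ∘ tr`** on `H^i(·, τ)` for every Hida element `g ∈ Δ`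
and `b' ≤ b ≤ c`, `1 ≤ c`, arbitrary coefficients, provided `Δ` contains the unipotent elements
`N(x) t_v` (`x` integral, `v ∣ p`) and the local elements at the good places.
[cite: Hida1994AIF, §2] [cite: KhareThorne2017, §6.2, Lemma 6.5] -/
theorem trCohomology_comp_heckeCohomology_level (h𝒰 : 𝒰.IsMaximalAbove) {b' b c : ℕ}
    (hU : (𝒰.level b c).toSubmonoid ≤ Δ) (hU' : (𝒰.level b' c).toSubmonoid ≤ Δ)
    (hb : b' ≤ b) (hbc : b ≤ c) (hc : 1 ≤ c) (i : ℕ)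
    (hNΔ : ∀ (v : HeightOneSpectrum (𝓞 K)), (p : 𝓞 K) ∈ v.asIdeal → ∀ x : v.adicCompletion K,
      Valued.v x ≤ 1 → globalUnipotent K v x * heckeElement 2 K v 1 ^ 1 ∈ Δ)
    (hlocΔ : ∀ (w : HeightOneSpectrum (𝓞 K)), w ∉ 𝒰.bad → (p : 𝓞 K) ∉ w.asIdeal →
      ∀ y : GL (Fin 2) (w.adicCompletion K), ofLocal 2 K w y ∈ Δ)
    {g : FiniteAdelicGL 2 K} (hg : g ∈ 𝒰.hidaElements) (hgΔ : g ∈ Δ) :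
    (trCohomology (globalEmbedding 2 K) Δ τ hU hU' i).hom ∘ₗ
        heckeCohomology (globalEmbedding 2 K) Δ τ (𝒰.level b c) hU hgΔ i =
      heckeCohomology (globalEmbedding 2 K) Δ τ (𝒰.level b' c) hU' hgΔ i ∘ₗ
        (trCohomology (globalEmbedding 2 K) Δ τ hU hU' i).hom := by
  classical
  have hle : 𝒰.level b c ≤ 𝒰.level b' c := 𝒰.level_antitone hb le_rfl
  -- the diamond transversal
  obtain ⟨S, hSb, hS⟩ := 𝒰.exists_diamond_transversal h𝒰 hbc (le_max_of_le_right hc) (b' := b')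
  have hS' := bijOn_image_of_bijOn (diamondPi 2 K p) hS
  have hmemS : ∀ s ∈ S.image (diamondPi 2 K p), ∃ u ∈ S, s = diamondPi 2 K p u := fun s hs => by
    obtain ⟨u, hu, rfl⟩ := Finset.mem_image.1 hs
    exact ⟨u, hu, rfl⟩
  have hSlevel : ∀ u ∈ S, diamondPi 2 K p u ∈ 𝒰.level b' c := fun u hu => 𝒰.diamondPi_mem_level h𝒰 c u (hSb u hu)
  obtain ⟨w, hw, ⟨d, hgd⟩, hcase⟩ := exists_place_of_mem_hidaElements_level 𝒰 h𝒰 hg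
  rcases hcase with rfl | ⟨hN, -⟩
  · by_cases hp : (p : 𝓞 K) ∈ w.asIdeal
    · -- `U_{w,1}`: unipotent family, index maps from `exists_sigma_unipotentFamily`
      have hex : ∀ s ∈ S.image (diamondPi 2 K p),
          ∃ σ : ArithmeticQuotient.doubleCosetQuot (𝒰.level c c) (heckeElement 2 K w 1 ^ 1) →
            ArithmeticQuotient.doubleCosetQuot (𝒰.level c c) (heckeElement 2 K w 1 ^ 1),
            ∀ j, ((s * 𝒰.unipotentFamily (v := w) c 1 j : FiniteAdelicGL 2 K) : FiniteAdelicGL 2 K ⧸ 𝒰.level b c) =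
              ((𝒰.unipotentFamily (v := w) c 1 (σ j) * s : FiniteAdelicGL 2 K) : FiniteAdelicGL 2 K ⧸ 𝒰.level b c) :=
        fun s hs => by
          obtain ⟨u, hu, rfl⟩ := hmemS s hs
          exact 𝒰.exists_sigma_unipotentFamily (v := w) h𝒰 hp hc hb hbc u (hSlevel u hu)
      choose σ hσ using hex
      have hgΔ' : heckeElement 2 K w 1 ^ 1 ∈ Δ := by rwa [pow_one]
      rw [heckeCohomology_congr (globalEmbedding 2 K) Δ τ (𝒰.level b c) hU hgΔ hgΔ' (pow_one _).symm i,
        heckeCohomology_congr (globalEmbedding 2 K) Δ τ (𝒰.level b' c) hU' hgΔ hgΔ' (pow_one _).symm i]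
      refine trCohomology_comp_heckeCohomology (globalEmbedding 2 K) Δ τ hU hU' hle hS'
        hgΔ' (𝒰.unipotentFamily (v := w) c 1)
        (fun j => hNΔ w hp _ (𝒰.unipotentRep_spec h𝒰 hp hc j.2).1)
        (𝒰.coe_unipotentFamily_bijOn_level h𝒰 hp hc hc)
        (𝒰.coe_unipotentFamily_bijOn_level h𝒰 hp hc hc)
        (fun s j => if h : s ∈ S.image (diamondPi 2 K p) then σ s h j else j)
        (fun s hs j => ?_) i
      rw [dif_pos hs]
      exact hσ s hs j
    · -- `T_{w,1}` at a good place: representatives commute with the transversal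
      have hw' : w ∉ 𝒰.bad := Or.resolve_right hw hp
      haveI := (𝒰.finite_localOrbit hw' b c (glDiagonal 2 (w.adicCompletion K) d)).fintype
      have hUnr := 𝒰.isUnramifiedLevel_levelAt_of_not_mem (fun v => iwahoriLevel 2 v.1 b c) hw'
      have hgΔ' : ofLocal 2 K w (glDiagonal 2 (w.adicCompletion K) d) ∈ Δ := by rwa [← hgd]
      rw [heckeCohomology_congr (globalEmbedding 2 K) Δ τ (𝒰.level b c) hU hgΔ hgΔ' hgd i,
        heckeCohomology_congr (globalEmbedding 2 K) Δ τ (𝒰.level b' c) hU' hgΔ hgΔ' hgd i]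
      refine trCohomology_comp_heckeCohomology (globalEmbedding 2 K) Δ τ hU hU' hle hS'
        hgΔ' _ (fun _ => hlocΔ w hw' hp _)
        (bijOn_localFamily hUnr _)
        (bijOn_localFamily (𝒰.isUnramifiedLevel_levelAt_of_not_mem (fun v => iwahoriLevel 2 v.1 b' c) hw') _)
        (fun _ j => j) (fun s hs j => ?_) i
      obtain ⟨u, hu, rfl⟩ := hmemS s hs
      rw [hUnr.comm_of_apply_eq_one _ (localComponent_diamondPi_of_not_mem u hp)]
  · -- normalising elements commuting with the transversal
    refine trCohomology_comp_heckeCohomology (globalEmbedding 2 K) Δ τ hU hU' hle hS'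
      hgΔ (fun _ : Unit => g) (fun _ => hgΔ)
      (bijOn_unit_of_normalizing _ (hN b c)) (bijOn_unit_of_normalizing _ (hN b' c))
      (fun _ j => j) (fun s hs j => ?_) i
    obtain ⟨u, hu, rfl⟩ := hmemS s hs
    rw [hgd, ← (commute_ofLocal_glDiagonal_diamondPi w d u).eq]

end TameLevel

end BigHeckeGLn

end Literature.NumberTheory.Automorphic
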